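import Summits.Ventures.YMGap.RobustBall.StarKernelSusceptibilityRate
import HarnessLib

/-!
# Venture YMGap, track DS (seat ds-3) — «C-KMIX-STAR», step 5b: the susceptibility rate in the shape `A · θ^M`

HONEST FRAMING. WHAT THIS IS: a venture file (cell `pub-ymgap`, track DS, seat ds-3; theorems only, no `def`, no named fact)
repackaging `StarKernelSusceptibilityRate.su2_wilson_kernel_susceptibility_star_rate` (explicit two-piece bound) as
`|χ_M^η(p) − χ(p)| ≤ A · θ^M` with `θ = max(R_G(β_W), ½)^{1/128} < 1` and `A = A(β_W, P)`: `SU(2)` lattice Yang–Mills on `ℤ⁴`, Wilson action,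
every `0 ≤ β_W ≤ 9/25`, every box `M > P`, EVERY boundary field `η`, every plaquette `p` based in `box 4 P`
(`su2_wilson_kernel_susceptibility_star_rate_geometric`; the polynomial prefactor `(2M+1)⁴` is absorbed by `exists_bound_poly_four_mul_pow`).
WHAT THIS IS NOT: `A` is not made explicit here (it is in the parent file); lattice strong coupling; nothing about the continuum limit or the
Clay problem.

References: the seat's `StarKernelSusceptibilityRate.lean`; Mathlib `tendsto_pow_const_mul_const_pow_of_abs_lt_one`.
-/

noncomputable section

open MeasureTheory Filter Function ProbabilityTheory Real Topology
open scoped NNReal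
open Literature.Probability.LatticeModels
open Literature.MathematicalPhysics.QuantumLattice
open Literature.MathematicalPhysics.QuantumFieldTheory hiding ZdEdge Site
open Summit.Ventures.YMGap.DSWindowZd
open Summit.Ventures.YMGap.StarWindowGauge (gaugeR gaugeR_lt_one_of_le)
open Summit.Ventures.YMGap.StarLemmaG (gaugeR_nonneg)

namespace Summit.Ventures.YMGap.RobustBall

/-- Polynomial times geometric is bounded: for `0 ≤ x < 1` there is `A ≥ 0` with `(2M+1)⁴ x^M ≤ A` for all `M`. [folklore] -/
theorem exists_bound_poly_four_mul_pow {x : ℝ} (hx0 : 0 ≤ x) (hx1 : x < 1) :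
    ∃ A : ℝ, 0 ≤ A ∧ ∀ M : ℕ, (2 * (M : ℝ) + 1) ^ 4 * x ^ M ≤ A := by
  set v : ℕ → ℝ := fun M => 81 * ((M : ℝ) ^ 4 * x ^ M) + x ^ M with hv
  have hv0 : ∀ M, 0 ≤ v M := fun M => by positivity
  have huv : ∀ M : ℕ, (2 * (M : ℝ) + 1) ^ 4 * x ^ M ≤ v M := by
    intro M
    rcases Nat.eq_zero_or_pos M with hM | hM
    · subst hM; simp [hv]
    · have h1 : (1 : ℝ) ≤ M := by exact_mod_cast hM
      have h2 : (2 * (M : ℝ) + 1) ^ 4 ≤ 81 * (M : ℝ) ^ 4 := by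
        have : 2 * (M : ℝ) + 1 ≤ 3 * M := by linarith
        calc (2 * (M : ℝ) + 1) ^ 4 ≤ (3 * M) ^ 4 := by gcongr
          _ = 81 * (M : ℝ) ^ 4 := by ring
      have hxM : 0 ≤ x ^ M := pow_nonneg hx0 M
      calc (2 * (M : ℝ) + 1) ^ 4 * x ^ M ≤ 81 * (M : ℝ) ^ 4 * x ^ M := mul_le_mul_of_nonneg_right h2 hxM
        _ ≤ v M := by rw [hv]; nlinarith
  have hlim : Tendsto v atTop (𝓝 0) := by
    have h1 := tendsto_pow_const_mul_const_pow_of_abs_lt_one 4 (show |x| < 1 by rwa [abs_of_nonneg hx0])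
    have h2 := tendsto_pow_atTop_nhds_zero_of_lt_one hx0 hx1
    have := (h1.const_mul 81).add h2
    simpa [hv] using this
  obtain ⟨N, hN⟩ := eventually_atTop.1 (hlim.eventually (gt_mem_nhds one_pos))
  refine ⟨1 + ∑ M ∈ Finset.range N, v M, by positivity, fun M => (huv M).trans ?_⟩
  rcases lt_or_ge M N with hM | hM
  · have : v M ≤ ∑ M ∈ Finset.range N, v M :=
      Finset.single_le_sum (fun M _ => hv0 M) (Finset.mem_range.2 hM)
    linarith
  · have := hN M hM
    have : 0 ≤ ∑ M ∈ Finset.range N, v M := Finset.sum_nonneg fun M _ => hv0 M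
    linarith

/-- ★★ **THE SAME, AS `A · θ^M`** (`SU(2)`, `ℤ⁴`, Wilson, EVERY `0 ≤ β_W ≤ 9/25`): for every `P` there are `A ≥ 0` and `0 < θ < 1`
(`θ = max(R_G(β_W), ½)^{1/128}`) such that for every `M > P`, EVERY boundary field `η` and every plaquette `p` based in `box 4 P`:
`|Σ_{q based in box M} cov_{γ_{box M}(·|η)}(W_p, W_q) − Σ_q cov_μ(W_p, W_q)| ≤ A · θ^M`. [folklore] -/
theorem su2_wilson_kernel_susceptibility_star_rate_geometric {βW : ℝ} (h0 : 0 ≤ βW) (h : βW ≤ 9 / 25) (P : ℕ) :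
    ∃ μ : Measure (LGConfig 4 (SUN 2)), ∃ A θ : ℝ,
      ymGibbsMeasures (d := 4) (fundamentalRep (Fin 2)) (βW / 2) = {μ} ∧ 0 ≤ A ∧ 0 < θ ∧ θ < 1 ∧
      ∀ M : ℕ, P < M → ∀ (η : LGConfig 4 (SUN 2)) (p : ZdPlaquette 4), p.1 ∈ box 4 P →
        |(∑ q ∈ (box 4 M) ×ˢ (Finset.univ : Finset {o : Fin 4 × Fin 4 // o.1 < o.2}),
            cov[zdPlaquetteObs (fundamentalRep (Fin 2)) p.1 p.2.1.1 p.2.1.2,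
              zdPlaquetteObs (fundamentalRep (Fin 2)) q.1 q.2.1.1 q.2.1.2;
              ymSpecification (d := 4) (fundamentalRep (Fin 2)) (βW / 2)
                ((box 4 M) ×ˢ (Finset.univ : Finset (Fin 4))) η]) -
            ∑' q : ZdPlaquette 4, cov[zdPlaquetteObs (fundamentalRep (Fin 2)) p.1 p.2.1.1 p.2.1.2,
              zdPlaquetteObs (fundamentalRep (Fin 2)) q.1 q.2.1.1 q.2.1.2; μ]| ≤ A * θ ^ M := by
  obtain ⟨μ, hG, hmain⟩ := su2_wilson_kernel_susceptibility_star_rate h0 h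
  have hρ0 : 0 ≤ gaugeR βW := gaugeR_nonneg h0 (by linarith)
  have hρ1 : gaugeR βW < 1 := gaugeR_lt_one_of_le h0 h
  set ρ' : ℝ := max (gaugeR βW) (1 / 2) with hρ'
  have hρ'0 : 0 < ρ' := lt_max_of_lt_right (by norm_num)
  have hρ'1 : ρ' < 1 := max_lt hρ1 (by norm_num)
  set t : ℝ := -Real.log ρ' with ht
  have ht0 : 0 < t := by rw [ht, neg_pos]; exact Real.log_neg hρ'0 hρ'1
  -- the rates: near `e^{−t/8}` (before the polynomial), far `e^{−t/64}`; common `θ = e^{−t/128}`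
  set θ : ℝ := Real.exp (-(t / 128)) with hθ
  have hθ0 : 0 < θ := Real.exp_pos _
  have hθ1 : θ < 1 := Real.exp_lt_one_iff.2 (by rw [neg_neg_iff_pos]; positivity)
  set x : ℝ := Real.exp (-(t / 8)) / θ with hx
  have hx0 : 0 ≤ x := by positivity
  have hx1 : x < 1 := by
    rw [hx, div_lt_one hθ0, hθ]
    exact Real.exp_lt_exp.2 (by linarith)
  obtain ⟨A₁, hA₁0, hA₁⟩ := exists_bound_poly_four_mul_pow hx0 hx1
  set s : ℝ := Real.exp (-(t / 32)) with hs
  have hs0 : 0 < s := Real.exp_pos _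
  have hs1 : s < 1 := Real.exp_lt_one_iff.2 (by rw [neg_neg_iff_pos]; positivity)
  set c₁ : ℝ := 6 * (1536 * Real.sqrt 2) * Real.exp (t * (1 + (P : ℝ) / 8)) with hc₁
  set c₂ : ℝ := 2 * (262144 * Real.exp (t * (P / 2 + 3 / 2))) * Real.exp (t / 64 * ((P : ℝ) + 1)) *
    (6 * ((1 + s) / (1 - s)) ^ 4) with hc₂
  have hc₁0 : 0 ≤ c₁ := by positivity
  have hc₂0 : 0 ≤ c₂ := by
    have : 0 < 1 - s := by linarith
    positivity
  refine ⟨μ, c₁ * A₁ + c₂, θ, hG, by positivity, hθ0, hθ1, fun M hPM η p hp => ?_⟩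
  obtain ⟨-, hb⟩ := hmain M P hPM η p hp
  refine hb.trans ?_
  clear hb hmain
  -- bookkeeping of the two exponents
  set L : ℕ := (M - P) / 2 with hL
  have hLle : P + L ≤ M := by omega
  have hL2 : (M : ℝ) - P - 1 ≤ 2 * (L : ℝ) := by
    have : M - P - 1 ≤ 2 * L := by omega
    have h' : ((M - P - 1 : ℕ) : ℝ) ≤ 2 * (L : ℝ) := by exact_mod_cast this
    have hPM' : P + 1 ≤ M := hPM
    rw [Nat.cast_sub (by omega), Nat.cast_sub hPM.le] at h'
    push_cast at h'
    linarith
  have hML : ((M : ℝ) - P) / 2 ≤ (M : ℝ) + 1 - ((P + L + 1 : ℕ) : ℝ) := by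
    have : 2 * L ≤ M - P := Nat.mul_div_le (M - P) 2 |>.trans_eq' (by ring)
    have h' : 2 * (L : ℝ) ≤ ((M - P : ℕ) : ℝ) := by exact_mod_cast this
    rw [Nat.cast_sub hPM.le] at h'
    push_cast
    linarith
  -- near piece
  have hk : ((M : ℝ) - P) / 8 - 1 ≤ (⌊((M : ℝ) + 1 - ((P + L + 1 : ℕ) : ℝ)) / (4 : ℕ)⌋₊ : ℕ) := by
    have := Nat.lt_floor_add_one (((M : ℝ) + 1 - ((P + L + 1 : ℕ) : ℝ)) / (4 : ℕ))
    have h4 : (((4 : ℕ) : ℝ)) = 4 := by norm_num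
    rw [h4] at this
    linarith
  have hnear : gaugeR βW ^ ⌊((M : ℝ) + 1 - ((P + L + 1 : ℕ) : ℝ)) / (4 : ℕ)⌋₊ ≤
      Real.exp (t * (1 + (P : ℝ) / 8)) * Real.exp (-(t / 8)) ^ M := by
    set k : ℕ := ⌊((M : ℝ) + 1 - ((P + L + 1 : ℕ) : ℝ)) / (4 : ℕ)⌋₊
    have hlog : Real.log ρ' ≤ 0 := by rw [ht] at ht0; linarith
    calc gaugeR βW ^ k ≤ ρ' ^ k := pow_le_pow_left₀ hρ0 (le_max_left _ _) _
      _ = Real.exp ((k : ℝ) * Real.log ρ') := by rw [Real.exp_nat_mul, Real.exp_log hρ'0]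
      _ ≤ Real.exp ((((M : ℝ) - P) / 8 - 1) * Real.log ρ') := Real.exp_le_exp.2 (mul_le_mul_of_nonpos_right hk hlog)
      _ = Real.exp (t * (1 + (P : ℝ) / 8)) * Real.exp (-(t / 8)) ^ M := by
          rw [← Real.exp_nat_mul, ← Real.exp_add, ht]; congr 1; ring
  have hpoly : (2 * ((P + L : ℕ) : ℝ) + 1) ^ 4 ≤ (2 * (M : ℝ) + 1) ^ 4 := by
    have : ((P + L : ℕ) : ℝ) ≤ M := by exact_mod_cast hLle
    gcongr
  have h1 : 6 * (2 * ((P + (M - P) / 2 : ℕ) : ℝ) + 1) ^ 4 * (1536 * Real.sqrt 2) *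
      gaugeR βW ^ ⌊((M : ℝ) + 1 - ((P + (M - P) / 2 + 1 : ℕ) : ℝ)) / (4 : ℕ)⌋₊ ≤ c₁ * A₁ * θ ^ M := by
    rw [← hL]
    have hθM : Real.exp (-(t / 8)) ^ M = x ^ M * θ ^ M := by
      rw [← mul_pow, hx, div_mul_cancel₀ _ hθ0.ne']
    have hθM0 : 0 ≤ θ ^ M := pow_nonneg hθ0.le M
    have hstep : 6 * (2 * ((P + L : ℕ) : ℝ) + 1) ^ 4 * (1536 * Real.sqrt 2) ≤ 6 * (2 * (M : ℝ) + 1) ^ 4 * (1536 * Real.sqrt 2) :=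
      mul_le_mul_of_nonneg_right (mul_le_mul_of_nonneg_left hpoly (by norm_num)) (by positivity)
    calc 6 * (2 * ((P + L : ℕ) : ℝ) + 1) ^ 4 * (1536 * Real.sqrt 2) * gaugeR βW ^ ⌊((M : ℝ) + 1 - ((P + L + 1 : ℕ) : ℝ)) / (4 : ℕ)⌋₊
        ≤ 6 * (2 * (M : ℝ) + 1) ^ 4 * (1536 * Real.sqrt 2) * (Real.exp (t * (1 + (P : ℝ) / 8)) * Real.exp (-(t / 8)) ^ M) :=
          mul_le_mul hstep hnear (pow_nonneg hρ0 _) (by positivity)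
      _ = c₁ * ((2 * (M : ℝ) + 1) ^ 4 * x ^ M) * θ ^ M := by rw [hθM, hc₁]; ring
      _ ≤ c₁ * A₁ * θ ^ M := mul_le_mul_of_nonneg_right (mul_le_mul_of_nonneg_left (hA₁ M) hc₁0) hθM0
  -- far piece
  have h2 : 2 * (262144 * Real.exp (-Real.log (max (gaugeR βW) (1 / 2)) * (P / 2 + 3 / 2))) *
      Real.exp (-(-Real.log (max (gaugeR βW) (1 / 2)) / 32)) ^ ((M - P) / 2) *
      (6 * ((1 + Real.exp (-(-Real.log (max (gaugeR βW) (1 / 2)) / 32))) /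
        (1 - Real.exp (-(-Real.log (max (gaugeR βW) (1 / 2)) / 32)))) ^ 4) ≤ c₂ * θ ^ M := by
    rw [← hρ', ← ht, ← hs, ← hL]
    have hsL : s ^ L ≤ Real.exp (t / 64 * ((P : ℝ) + 1)) * θ ^ M := by
      have ht32 : -(t / 32) ≤ 0 := by linarith
      have hL2' : ((M : ℝ) - P - 1) / 2 ≤ (L : ℝ) := by linarith
      have htM : 0 ≤ t * (M : ℝ) := by positivity
      calc s ^ L = Real.exp (-(t / 32) * L) := by rw [hs, ← Real.exp_nat_mul]; congr 1; ring
        _ ≤ Real.exp (-(t / 32) * (((M : ℝ) - P - 1) / 2)) := Real.exp_le_exp.2 (mul_le_mul_of_nonpos_left hL2' ht32)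
        _ ≤ Real.exp (t / 64 * ((P : ℝ) + 1)) * θ ^ M := by
            rw [hθ, ← Real.exp_nat_mul, ← Real.exp_add]
            exact Real.exp_le_exp.2 (by linarith)
    have hG0 : 0 ≤ 6 * ((1 + s) / (1 - s)) ^ 4 := by
      have : 0 < 1 - s := by linarith
      positivity
    calc 2 * (262144 * Real.exp (t * (P / 2 + 3 / 2))) * s ^ L * (6 * ((1 + s) / (1 - s)) ^ 4)
        ≤ 2 * (262144 * Real.exp (t * (P / 2 + 3 / 2))) * (Real.exp (t / 64 * ((P : ℝ) + 1)) * θ ^ M) *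
            (6 * ((1 + s) / (1 - s)) ^ 4) :=
          mul_le_mul_of_nonneg_right (mul_le_mul_of_nonneg_left hsL (by positivity)) hG0
      _ = c₂ * θ ^ M := by rw [hc₂]; ring
  have := add_le_add h1 h2
  linarith [this]

end Summit.Ventures.YMGap.RobustBall

end
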